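import Summits.ResolutionOfSingularities.ResolutionOfSingularities.Theorems.HomologicalConductorNoZenoExhaustionExcludesTermination
import Summits.ResolutionOfSingularities.ResolutionOfSingularities.Theorems.HomologicalConductorNoZenoIffKernel
import Summits.ResolutionOfSingularities.ResolutionOfSingularities.Theorems.HomologicalConductorPersistenceRadicalProof
import Summits.ResolutionOfSingularities.ResolutionOfSingularities.Theorems.SharpStrataSepExcModelsModelValuationOrder
import HarnessLib

/-!
# Crux `NoZenoR` (stmt-ResolutionOfSingularities-19943): the DISCRETE DOMINATOR of a regular stage —
# kernel towers NEVER terminate (no exhaustion needed), and `NoZenoR` ⟺ «every ca-tower has a noetherian weak dominator»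

OURS (cell res-hironaka, crux chain W4.4; lead res-L0-w44-lead-1 g11, OBJECT 5-A = the UNPROVED REMARK handed on by lead g10
(HOME `L/res-L0-w44-lead-1/HANDOFF.md`, gen 10 FINAL), here made a tree theorem).  AI-written, weaker than expert review; nothing here
is a statement of the manuscript under review (Hironaka 2017).  SUPPORT-level, counted 0.  Def-free, fact-free, every transcendence degree.

* `exists_noetherian_valuationSubring_of_span_singleton` — the discrete valuation ring of a non-zero principal prime of a noetherian
  domain, realised in the fraction field, WITH its noetherianity exported (the tree's
  `SepExcModels.ModelValuationOrder.exists_valuationSubring_of_span_singleton` forgets it).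
* `exists_discreteDominator` — **a regular local ring `S ⊆ K = Frac S` is weakly dominated by a NOETHERIAN valuation ring `V` of `K`**:
  `S ⊆ V` and every `s ∈ S` invertible in `V` is a unit of `S` (for `dim S ≥ 1` the order valuation = the DVR of the exceptional prime of the
  first quadratic transform, `exists_orderValuation`'s construction; for `dim S = 0`, `V = K`).
* `exists_discreteDominator_of_isRegularLocalRing` — a REGULAR STAGE `T_M` of the ca-tower hands the WHOLE tower a noetherian weak dominator
  (earlier stages lie in `T_M`, later ones equal it: `NoetherianCapture.tower_eq_of_le_of_isRegularLocalRing`).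
* `not_isRegularLocalRing_of_kernel` — **under the kernel binder `hker` NO stage is regular** (no exhaustion, no `hmax`, no tr.deg clause):
  strict strengthening of `Exhaustion.not_isRegularLocalRing_of_exhaustive` (2-Z, p593588) and of tri-1's
  `Negative.surfaceKernel_not_isRegularLocalRing_tower` (tr.deg ≤ 2).  `kernel_terminates_iff_false`: the conclusion `∃ m, IsRegularLocalRing (T_m)`
  of EVERY kernel text is equivalent to `False` under its own binders — every kernel residual of the registry (slot 2 β1ʳ¹♯ incl. its
  NON-exhaustive branch (b), Cap3 / BoundedRung3 / CapHigh, Exh3 / ExhHigh, KernelHigh, and slot 3 through `CompositeSplit.terminates_of_noChain`)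
  is a NON-EXISTENCE statement: «no datum meets the binders».
* `noZenoR_iff` (ζ/δ re-abstraction) and **`noZenoR_iff_discreteDominator : NoZenoR ↔ (StrictDrop → every admissible datum `(k, K, O, A)`
  has a NOETHERIAN valuation ring `O'` of `K` weakly dominating its ca-tower)** — `→`: `PersistenceRadical` is a tree theorem
  (`persistenceRadical_proof`), so `NoZenoR` terminates every tower and the regular stage supplies the dominator; `←`: dominance invariance
  (`stub_dominanceInvariance`) + the noetherian case (`stub_noetherianCase`), exactly as in `noZeno_iff_kernel`.  READING: the crux asks, for
  every valuation `O` whose ring is not noetherian, for a DISCRETE rank-one (or trivial) valuation dominating every stage of the `O`-tower.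
* TEXT LEVEL: `beta1RankOneSharp_iff_noDatum` (registered slot-2 text, BOTH branches), `kernelHigh_iff_noDatum`, `kernelText_iff_noDatum`.
-/

noncomputable section

-- single-problem summit: the doubled namespace component `ResolutionOfSingularities` is forced
set_option linter.dupNamespace false

namespace Summit.ResolutionOfSingularities.ResolutionOfSingularities.Theorems.NoZeno.DiscreteDominator

open Summit.ResolutionOfSingularities.ResolutionOfSingularities.Theses.HomologicalConductor
open Summit.ResolutionOfSingularities.ResolutionOfSingularities.Theorems.NoZeno.Birth
open Summit.ResolutionOfSingularities.ResolutionOfSingularities.Theorems.NoZeno.SandwichCluster.Parasite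
open Summit.ResolutionOfSingularities.ResolutionOfSingularities.Theorems
open Summit.ResolutionOfSingularities.ResolutionOfSingularities.Theorems.NoZeno
open Summit.ResolutionOfSingularities.ResolutionOfSingularities.Theorems.SepExcModels.ModelValuationOrder
open Literature.AlgebraicGeometry.Resolution IsLocalRing

/-! ## The DVR of a principal prime, with noetherianity exported -/

section PrincipalPrime

variable {T K : Type} [CommRing T] [IsDomain T] [IsNoetherianRing T] [Field K] [Algebra T K]
  [IsFractionRing T K]

/-- **The local ring at a non-zero principal prime `(t)` of a noetherian domain `T ⊆ K = Frac T` is a NOETHERIAN valuation ring of `K`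
containing `T` with `(t) ⊆ 𝔪`** (a discrete valuation ring, `IsDiscreteValuationRing.TFAE`; same construction as the tree's
`exists_valuationSubring_of_span_singleton`, keeping `IsNoetherianRing`). [cite: ZariskiSamuel1960, Ch. VI §10; folklore] -/
theorem exists_noetherian_valuationSubring_of_span_singleton (t : T) (ht : t ≠ 0) (𝔭 : Ideal T)
    [𝔭.IsPrime] (h𝔭 : 𝔭 = Ideal.span {t}) :
    ∃ (O : ValuationSubring K) (ψ : T →+* O), IsNoetherianRing ↥O ∧
      (∀ b : T, (ψ b : K) = algebraMap T K b) ∧ 𝔭 ≤ (maximalIdeal O).comap ψ := by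
  classical
  subst h𝔭
  set 𝔭 : Ideal T := Ideal.span {t} with h𝔭
  set O' := Localization.AtPrime 𝔭 with hO'
  haveI : IsNoetherianRing O' := IsLocalization.isNoetherianRing 𝔭.primeCompl O' inferInstance
  have hinjT : Function.Injective (algebraMap T O') :=
    IsLocalization.injective O' 𝔭.primeCompl_le_nonZeroDivisors
  have hmax : maximalIdeal O' = Ideal.span {algebraMap T O' t} := by
    rw [← IsLocalization.AtPrime.map_eq_maximalIdeal 𝔭 O']
    show Ideal.map (algebraMap T O') (Ideal.span {t}) = _
    rw [Ideal.map_span, Set.image_singleton]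
  have hnf : ¬ IsField O' := by
    rw [IsLocalRing.isField_iff_maximalIdeal_eq, hmax, Ideal.span_singleton_eq_bot]
    exact fun h0 => ht (hinjT (by rw [h0, map_zero]))
  have hprinc : (maximalIdeal O').IsPrincipal := ⟨⟨algebraMap T O' t, by rw [hmax]⟩⟩
  haveI hV : ValuationRing O' := ((IsDiscreteValuationRing.TFAE O' hnf).out 4 1).mp hprinc
  have hunit : ∀ s : 𝔭.primeCompl, IsUnit (algebraMap T K s) := fun s =>
    IsLocalization.map_units K ⟨(s : T), 𝔭.primeCompl_le_nonZeroDivisors s.2⟩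
  letI algO'K : Algebra O' K := (IsLocalization.lift (M := 𝔭.primeCompl) (S := O') hunit).toAlgebra
  haveI : IsScalarTower T O' K :=
    IsScalarTower.of_algebraMap_eq fun b => (IsLocalization.lift_eq hunit b).symm
  haveI : IsFractionRing O' K :=
    IsFractionRing.isFractionRing_of_isDomain_of_isLocalization 𝔭.primeCompl O' K
  obtain ⟨O, e, he⟩ := exists_valuationSubring_equiv O' K
  let ψ : T →+* O := e.toRingHom.comp (algebraMap T O')
  have hψ : ∀ b : T, (ψ b : K) = algebraMap T K b := fun b => by
    show ((e (algebraMap T O' b) : O) : K) = algebraMap T K b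
    rw [he, ← IsScalarTower.algebraMap_apply]
  have hdom : 𝔭 ≤ (maximalIdeal O).comap ψ := by
    intro b hb
    rw [Ideal.mem_comap]
    have hb' : algebraMap T O' b ∈ maximalIdeal O' := by
      rw [← IsLocalization.AtPrime.map_eq_maximalIdeal 𝔭 O']
      exact Ideal.mem_map_of_mem _ hb
    rw [← map_ringEquiv_maximalIdeal e]
    exact Ideal.mem_map_of_mem _ hb'
  exact ⟨O, ψ, isNoetherianRing_of_ringEquiv O' e, hψ, hdom⟩

end PrincipalPrime

/-! ## The discrete dominator of a regular local ring -/

/-- **A regular local ring is weakly dominated by a noetherian valuation ring of its fraction field.**  For `S` regular local with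
`K = Frac S` there is a valuation ring `V` of `K`, NOETHERIAN, with `S ⊆ V` and UNIT REFLECTION: a non-zero `s ∈ S` whose inverse lies in `V`
is a unit of `S`.  If `dim S = 0`, `V = K`; if `dim S ≥ 1`, `V` is the ORDER VALUATION ring of `S` (the discrete valuation ring of the
exceptional prime `(x₁)` of the chart `S[𝔪/x₁]` of the blowing up of the closed point, `x` a regular system of parameters), which dominates `S`.
[cite: ZariskiSamuel1960, Ch. VI §14 and Appendix 5; folklore] -/
theorem exists_discreteDominator (S K : Type) [CommRing S] [IsRegularLocalRing S] [Field K] [Algebra S K]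
    [IsFractionRing S K] :
    ∃ V : ValuationSubring K, IsNoetherianRing ↥V ∧ (∀ s : S, algebraMap S K s ∈ V) ∧
      ∀ s : S, algebraMap S K s ≠ 0 → (algebraMap S K s)⁻¹ ∈ V → IsUnit s := by
  classical
  haveI : IsDomain S := isDomain_of_isRegularLocalRing S
  by_cases hS : maximalIdeal S = ⊥
  · -- `S` is a field: `V = K`
    refine ⟨⊤, ?_, fun s => ValuationSubring.mem_top _, fun s hs _ => ?_⟩
    · let e : K ≃+* ↥(⊤ : ValuationSubring K) :=
        { toFun := fun x => ⟨x, ValuationSubring.mem_top x⟩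
          invFun := fun x => x.1
          left_inv := fun _ => rfl
          right_inv := fun _ => rfl
          map_mul' := fun _ _ => rfl
          map_add' := fun _ _ => rfl }
      exact isNoetherianRing_of_ringEquiv K e
    · have hs0 : s ∉ maximalIdeal S := by
        rw [hS, Ideal.mem_bot]
        rintro rfl
        exact hs (map_zero _)
      by_contra hu
      exact hs0 ((IsLocalRing.mem_maximalIdeal s).mpr (mem_nonunits_iff.mpr hu))
  · -- `dim S ≥ 1`: the order valuation
    obtain ⟨c, hc⟩ := exists_regularSystemOfParameters (R := S)
    have hd : (maximalIdeal S).spanFinrank = (maximalIdeal S).spanFinrank := rfl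
    have hd0 : 0 < (maximalIdeal S).spanFinrank := by
      by_contra h0
      have h0' : (maximalIdeal S).spanFinrank = 0 := by omega
      apply hS
      rw [← hc, Ideal.span_eq_bot]
      rintro _ ⟨j, rfl⟩
      exact (Fin.elim0 (Fin.cast h0' j) : _)
    let i : Fin (maximalIdeal S).spanFinrank := ⟨0, hd0⟩
    have hci : algebraMap S K (c i) ≠ 0 := fun h =>
      rsop_ne_zero hd c hc i ((injective_iff_map_eq_zero _).mp (IsFractionRing.injective S K) _ h)
    haveI : IsDomain (chartRing c i) := isDomain_chart c i hci
    haveI : IsNoetherianRing (chartRing c i) := isNoetherianRing_chart c i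
    letI algTK : Algebra (chartRing c i) K := (chartToField c i (algebraMap S K) hci).toAlgebra
    haveI : IsFractionRing (chartRing c i) K := isFractionRing_chart c i hci
    haveI h𝔭 : (Ideal.span {chartBase c i (c i)}).IsPrime := isPrime_excIdeal hd c hc i
    obtain ⟨V, ψT, hVN, hψT, hdomT⟩ := exists_noetherian_valuationSubring_of_span_singleton (K := K)
      (chartBase c i (c i)) (chartBase_ne_zero c i hci) (Ideal.span {chartBase c i (c i)}) rfl
    -- the map `S → V` and domination
    let ψ : S →+* V := ψT.comp (chartBase c i)
    have hψ : ∀ s : S, (ψ s : K) = algebraMap S K s := fun s => by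
      show ((ψT (chartBase c i s) : V) : K) = algebraMap S K s
      rw [hψT]
      exact chartToField_reesChartBase c i (algebraMap S K) hci s
    have hdom : maximalIdeal S ≤ (maximalIdeal V).comap ψ := by
      intro s hs
      rw [Ideal.mem_comap]
      have hs' : chartBase c i s ∈ Ideal.span {chartBase c i (c i)} := by
        rw [← hc] at hs
        exact reesChartBase_mem_span_of_mem c i hs
      exact hdomT hs'
    refine ⟨V, hVN, fun s => by rw [← hψ]; exact (ψ s).2, fun s hs hinv => ?_⟩
    by_contra hu
    have hmem : ψ s ∈ maximalIdeal V := hdom ((IsLocalRing.mem_maximalIdeal s).mpr (mem_nonunits_iff.mpr hu))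
    -- but `ψ s` is a unit of `V`: its inverse in `K` lies in `V`
    have hunitV : IsUnit (ψ s) := by
      refine isUnit_iff_exists_inv.mpr ⟨⟨(algebraMap S K s)⁻¹, hinv⟩, Subtype.ext ?_⟩
      show (ψ s : K) * (algebraMap S K s)⁻¹ = 1
      rw [hψ, mul_inv_cancel₀ hs]
    exact (mem_nonunits_iff.mp ((IsLocalRing.mem_maximalIdeal _).mp hmem)) hunitV

/-! ## A regular stage hands the whole tower a noetherian weak dominator -/

variable {k K : Type} [Field k] [Field K] [Algebra k K]

/-- **THE DISCRETE DOMINATOR OF A REGULAR STAGE.**  If `T_M` is regular then some NOETHERIAN valuation ring `O'` of `K` weakly dominates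
the whole ca-tower along `O`: every stage lies in `O'` (earlier stages lie in `T_M`, later ones equal it) and a stage element invertible in
`O'` is invertible in `O` (it is a unit of the local ring `T_M ⊆ O`).  [this work; cite: ZariskiSamuel1960, Ch. VI §14] -/
theorem exists_discreteDominator_of_isRegularLocalRing (O : ValuationSubring K) (A : Subalgebra k K)
    (hk : ∀ c : k, algebraMap k K c ∈ O) (hfr : IsFractionRing ↥A K) (hAO : A.toSubring ≤ O.toSubring)
    (M : ℕ) (hreg : IsRegularLocalRing ↥(tower O A M)) :
    ∃ O' : ValuationSubring K, IsNoetherianRing ↥O' ∧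
      ∀ m : ℕ, ∀ s ∈ tower O A m, s ∈ O' ∧ (s⁻¹ ∈ O' → s⁻¹ ∈ O) := by
  haveI := hfr
  haveI := hreg
  haveI : IsFractionRing ↥(tower O A M) K :=
    isFractionRing_subalgebra_of_le A (tower O A M) (fun a ha => mem_tower_of_mem O A M a ha)
  obtain ⟨V, hVN, hTV, hunit⟩ := exists_discreteDominator (↥(tower O A M)) K
  have hTM : ∀ m : ℕ, ∀ s ∈ tower O A m, s ∈ tower O A M := fun m s hs => by
    rcases le_total m M with h | h
    · exact d2rc_mem_tower_of_le O A h hs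
    · rw [← NoetherianCapture.tower_eq_of_le_of_isRegularLocalRing O A hk hfr hAO M hreg m h]
      exact hs
  refine ⟨V, hVN, fun m s hs => ?_⟩
  have hsM : s ∈ tower O A M := hTM m s hs
  refine ⟨hTV ⟨s, hsM⟩, fun hinv => ?_⟩
  by_cases hs0 : s = 0
  · rw [hs0, inv_zero]; exact O.zero_mem
  · obtain ⟨u, hu⟩ := hunit ⟨s, hsM⟩ hs0 hinv
    have h1 : s * ((↑(u⁻¹) : ↥(tower O A M)) : K) = 1 := by
      have h := congrArg (fun z : ↥(tower O A M) => (z : K)) (Units.mul_inv u)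
      simp only [Subalgebra.coe_mul, hu, Subalgebra.coe_one] at h
      exact h
    rw [inv_eq_of_mul_eq_one_right h1]
    exact mem_valuationSubring_of_mem_tower O hk hAO M _ (Subtype.mem _)

/-- **KERNEL TOWERS NEVER TERMINATE** (no exhaustion, no `hmax`, no transcendence-degree clause): under the kernel binder `hker` — every
valuation ring weakly dominating the tower is non-noetherian — NO stage is regular. [this work] -/
theorem not_isRegularLocalRing_of_kernel (O : ValuationSubring K) (A : Subalgebra k K)
    (hk : ∀ c : k, algebraMap k K c ∈ O) (hfr : IsFractionRing ↥A K) (hAO : A.toSubring ≤ O.toSubring)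
    (hker : ∀ O' : ValuationSubring K,
      (∀ m : ℕ, ∀ s ∈ tower O A m, s ∈ O' ∧ (s⁻¹ ∈ O' → s⁻¹ ∈ O)) → ¬ IsNoetherianRing ↥O')
    (M : ℕ) : ¬ IsRegularLocalRing ↥(tower O A M) := fun hreg => by
  obtain ⟨O', hN, hdom⟩ := exists_discreteDominator_of_isRegularLocalRing O A hk hfr hAO M hreg
  exact hker O' hdom hN

/-- Under the kernel binder the conclusion `∃ m, IsRegularLocalRing (T_m)` is equivalent to `False`. [this work] -/
theorem kernel_terminates_iff_false (O : ValuationSubring K) (A : Subalgebra k K)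
    (hk : ∀ c : k, algebraMap k K c ∈ O) (hfr : IsFractionRing ↥A K) (hAO : A.toSubring ≤ O.toSubring)
    (hker : ∀ O' : ValuationSubring K,
      (∀ m : ℕ, ∀ s ∈ tower O A m, s ∈ O' ∧ (s⁻¹ ∈ O' → s⁻¹ ∈ O)) → ¬ IsNoetherianRing ↥O') :
    (∃ m : ℕ, IsRegularLocalRing ↥(tower O A m)) ↔ False :=
  ⟨fun ⟨m, hm⟩ => not_isRegularLocalRing_of_kernel O A hk hfr hAO hker m hm, False.elim⟩

/-! ## `NoZenoR` ⟺ every ca-tower has a noetherian weak dominator -/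
/-- **`NoZenoR` restated over the named tower** (ζ/δ re-abstraction of one term, as `noZeno_iff`). [folklore] -/
theorem noZenoR_iff : NoZenoR ↔ (PersistenceRadical → StrictDrop → ∀ p : ℕ, p.Prime →
    ∀ (k K : Type) [Field k] [CharP k p] [Field K] [Algebra k K] (O : ValuationSubring K)
      (A : Subalgebra k K), (∀ c : k, algebraMap k K c ∈ O) → A.FG → IsFractionRing ↥A K →
      A.toSubring ≤ O.toSubring → ∃ m : ℕ, IsRegularLocalRing ↥(tower O A m)) :=
  ⟨fun h hP hD p hp k K _ _ _ _ O A hk hfg hfr hAO => h hP hD p hp k K O A hk hfg hfr hAO,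
    fun h hP hD p hp k K _ _ _ _ O A hk hfg hfr hAO => h hP hD p hp k K O A hk hfg hfr hAO⟩

/-- **`NoZenoR` ⟺ «given `StrictDrop`, every admissible ca-tower is weakly dominated by a NOETHERIAN valuation ring».**
`→`: `PersistenceRadical` holds in the tree (`persistenceRadical_proof`), so `NoZenoR` and `StrictDrop` terminate every tower, and the regular
stage supplies the dominator (`exists_discreteDominator_of_isRegularLocalRing`).  `←`: a noetherian weak dominator `O'` has the same tower
(`stub_dominanceInvariance`, stages noetherian by `stub_towerNoetherian`) and `StrictDrop` alone terminates the `O'`-tower (`stub_noetherianCase`).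
So the crux's whole content is: along a NON-noetherian valuation ring `O`, produce a discrete rank-one (or trivial) valuation of `K` dominating
every stage of the `O`-tower. [this work] -/
theorem noZenoR_iff_discreteDominator : NoZenoR ↔ (StrictDrop → ∀ p : ℕ, p.Prime →
    ∀ (k K : Type) [Field k] [CharP k p] [Field K] [Algebra k K] (O : ValuationSubring K)
      (A : Subalgebra k K), (∀ c : k, algebraMap k K c ∈ O) → A.FG → IsFractionRing ↥A K →
      A.toSubring ≤ O.toSubring →
      ∃ O' : ValuationSubring K, IsNoetherianRing ↥O' ∧
        ∀ m : ℕ, ∀ s ∈ tower O A m, s ∈ O' ∧ (s⁻¹ ∈ O' → s⁻¹ ∈ O)) := by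
  constructor
  · intro h hD p hp k K _ _ _ _ O A hk hA hfr hAO
    obtain ⟨M, hM⟩ := noZenoR_iff.mp h persistenceRadical_proof hD p hp k K O A hk hA hfr hAO
    exact exists_discreteDominator_of_isRegularLocalRing O A hk hfr hAO M hM
  · intro h
    refine noZenoR_iff.mpr fun _hP hD p hp k K _ _ _ _ O A hk hA hfr hAO => ?_
    obtain ⟨O', hN, hdom⟩ := h hD p hp k K O A hk hA hfr hAO
    have hTeq : ∀ m : ℕ, tower O' A m = tower O A m := fun m =>
      stub_dominanceInvariance k K O O' A hk hAO
        (fun n => stub_towerNoetherian k K O A hk hA hfr hAO n) hdom m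
    have hk' : ∀ c : k, algebraMap k K c ∈ O' :=
      fun c => (hdom 0 _ ((tower O A 0).algebraMap_mem c)).1
    have hAO' : A.toSubring ≤ O'.toSubring :=
      fun a ha => (hdom 0 a (mem_tower_of_mem O A 0 a ha)).1
    obtain ⟨m, hm⟩ := stub_noetherianCase hD p hp k K O' A hk' hA hfr hAO' hN
    exact ⟨m, hTeq m ▸ hm⟩

/-- The kernel form of the crux (as `noZeno_iff_kernel`, for `NoZenoR`, with `PersistenceRadical` discharged): `NoZenoR` ⟺ «given
`StrictDrop`, NO admissible datum satisfies the kernel binder». [this work] -/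
theorem noZenoR_iff_noKernelDatum : NoZenoR ↔ (StrictDrop → ∀ p : ℕ, p.Prime →
    ∀ (k K : Type) [Field k] [CharP k p] [Field K] [Algebra k K] (O : ValuationSubring K)
      (A : Subalgebra k K), (∀ c : k, algebraMap k K c ∈ O) → A.FG → IsFractionRing ↥A K →
      A.toSubring ≤ O.toSubring →
      ¬ (∀ O' : ValuationSubring K,
        (∀ m : ℕ, ∀ s ∈ tower O A m, s ∈ O' ∧ (s⁻¹ ∈ O' → s⁻¹ ∈ O)) → ¬ IsNoetherianRing ↥O')) := by
  rw [noZenoR_iff_discreteDominator]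
  refine ⟨fun h hD p hp k K _ _ _ _ O A hk hA hfr hAO hker => ?_,
    fun h hD p hp k K _ _ _ _ O A hk hA hfr hAO => ?_⟩
  · obtain ⟨O', hN, hdom⟩ := h hD p hp k K O A hk hA hfr hAO
    exact hker O' hdom hN
  · by_contra hno
    refine h hD p hp k K O A hk hA hfr hAO fun O' hdom hN => hno ⟨O', hN, hdom⟩


/-! ## TEXT LEVEL: the kernel residuals are non-existence statements (no exhaustion needed) -/

/-- **β1ʳ¹♯ ⟺ «no datum meets its binders»** — the registered slot-2 text (`Coarsening.Sig.stub_beta1RankOneSharp` of registry v33, written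
out verbatim, BOTH branches: exhaustive (a) AND the non-exhaustive branch (b) of an unreachable residually transcendental `t`).  2-Z had this
only for the exhaustive halves. [this work; iff-reading] -/
theorem beta1RankOneSharp_iff_noDatum :
    (PersistenceRadical → StrictDrop → ∀ p : ℕ, p.Prime → ∀ (k K : Type) [Field k] [CharP k p] [Field K]
      [Algebra k K] (O : ValuationSubring K) (A : Subalgebra k K), (∀ c : k, algebraMap k K c ∈ O) →
      A.FG → IsFractionRing ↥A K → A.toSubring ≤ O.toSubring →
      (∀ O' : ValuationSubring K,
        (∀ m : ℕ, ∀ s ∈ tower O A m, s ∈ O' ∧ (s⁻¹ ∈ O' → s⁻¹ ∈ O)) → ¬ IsNoetherianRing ↥O') →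
      (∀ O' : ValuationSubring K, O < O' → ∃ m : ℕ, ∃ s ∈ tower O A m, s⁻¹ ∈ O' ∧ s⁻¹ ∉ O) →
      (∀ (k' K' : Type) [Field k'] [CharP k' p] [Field K'] [Algebra k' K'] (O' : ValuationSubring K')
        (A' : Subalgebra k' K'), (∀ c : k', algebraMap k' K' c ∈ O') → A'.FG → IsFractionRing ↥A' K' →
        A'.toSubring ≤ O'.toSubring → Algebra.trdeg k' K' < Algebra.trdeg k K →
        ∃ m : ℕ, IsRegularLocalRing ↥(tower O' A' m)) →
      (∀ m : ℕ, ∀ s ∈ tower O A m, ∃ f : Polynomial k, f ≠ 0 ∧ O.valuation (Polynomial.aeval s f) < 1) →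
      3 ≤ Algebra.trdeg k K →
      (∀ O₁ : ValuationSubring K, O < O₁ → O₁ = ⊤) →
      ((∀ x : K, x ∈ O → ∃ m : ℕ, x ∈ tower O A m) ∨
        (∃ t : K, t ∈ O ∧ (∀ m : ℕ, t ∉ tower O A m) ∧
          ∀ f : Polynomial k, f ≠ 0 → ¬ O.valuation (Polynomial.aeval t f) < 1)) →
      ¬ SingularPrimeThread O A →
      ∃ m : ℕ, IsRegularLocalRing ↥(tower O A m)) ↔
    (PersistenceRadical → StrictDrop → ∀ p : ℕ, p.Prime → ∀ (k K : Type) [Field k] [CharP k p] [Field K]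
      [Algebra k K] (O : ValuationSubring K) (A : Subalgebra k K), (∀ c : k, algebraMap k K c ∈ O) →
      A.FG → IsFractionRing ↥A K → A.toSubring ≤ O.toSubring →
      (∀ O' : ValuationSubring K,
        (∀ m : ℕ, ∀ s ∈ tower O A m, s ∈ O' ∧ (s⁻¹ ∈ O' → s⁻¹ ∈ O)) → ¬ IsNoetherianRing ↥O') →
      (∀ O' : ValuationSubring K, O < O' → ∃ m : ℕ, ∃ s ∈ tower O A m, s⁻¹ ∈ O' ∧ s⁻¹ ∉ O) →
      (∀ (k' K' : Type) [Field k'] [CharP k' p] [Field K'] [Algebra k' K'] (O' : ValuationSubring K')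
        (A' : Subalgebra k' K'), (∀ c : k', algebraMap k' K' c ∈ O') → A'.FG → IsFractionRing ↥A' K' →
        A'.toSubring ≤ O'.toSubring → Algebra.trdeg k' K' < Algebra.trdeg k K →
        ∃ m : ℕ, IsRegularLocalRing ↥(tower O' A' m)) →
      (∀ m : ℕ, ∀ s ∈ tower O A m, ∃ f : Polynomial k, f ≠ 0 ∧ O.valuation (Polynomial.aeval s f) < 1) →
      3 ≤ Algebra.trdeg k K →
      (∀ O₁ : ValuationSubring K, O < O₁ → O₁ = ⊤) →
      ((∀ x : K, x ∈ O → ∃ m : ℕ, x ∈ tower O A m) ∨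
        (∃ t : K, t ∈ O ∧ (∀ m : ℕ, t ∉ tower O A m) ∧
          ∀ f : Polynomial k, f ≠ 0 → ¬ O.valuation (Polynomial.aeval t f) < 1)) →
      ¬ SingularPrimeThread O A →
      False) := by
  constructor
  · intro h hP hD p hp k K _ _ _ _ O A hk hA hfr hAO hker hmax IH hzd htr hr1 hab hthr
    obtain ⟨m, hm⟩ := h hP hD p hp k K O A hk hA hfr hAO hker hmax IH hzd htr hr1 hab hthr
    exact not_isRegularLocalRing_of_kernel O A hk hfr hAO hker m hm
  · intro h hP hD p hp k K _ _ _ _ O A hk hA hfr hAO hker hmax IH hzd htr hr1 hab hthr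
    exact (h hP hD p hp k K O A hk hA hfr hAO hker hmax IH hzd htr hr1 hab hthr).elim

/-- **KernelHigh ⟺ «no kernel datum of transcendence degree ≥ 4»** — the ONE text carrying the four frontier halves of the registry
(`KernelHigh.exhHigh_of_kernelHigh` / `capHigh_of_kernelHigh` / `h_of_kernelHigh` / `threadHigh_of_kernelHigh`, p593099) is itself a
non-existence statement. [this work; iff-reading] -/
theorem kernelHigh_iff_noDatum :
    (PersistenceRadical → StrictDrop → ∀ p : ℕ, p.Prime → ∀ (k K : Type) [Field k] [CharP k p] [Field K]
      [Algebra k K] (O : ValuationSubring K) (A : Subalgebra k K), (∀ c : k, algebraMap k K c ∈ O) →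
      A.FG → IsFractionRing ↥A K → A.toSubring ≤ O.toSubring →
      (∀ O' : ValuationSubring K,
        (∀ m : ℕ, ∀ s ∈ tower O A m, s ∈ O' ∧ (s⁻¹ ∈ O' → s⁻¹ ∈ O)) → ¬ IsNoetherianRing ↥O') →
      (∀ O' : ValuationSubring K, O < O' → ∃ m : ℕ, ∃ s ∈ tower O A m, s⁻¹ ∈ O' ∧ s⁻¹ ∉ O) →
      (∀ (k' K' : Type) [Field k'] [CharP k' p] [Field K'] [Algebra k' K'] (O' : ValuationSubring K')
        (A' : Subalgebra k' K'), (∀ c : k', algebraMap k' K' c ∈ O') → A'.FG → IsFractionRing ↥A' K' →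
        A'.toSubring ≤ O'.toSubring → Algebra.trdeg k' K' < Algebra.trdeg k K →
        ∃ m : ℕ, IsRegularLocalRing ↥(tower O' A' m)) →
      (∀ m : ℕ, ∀ s ∈ tower O A m, ∃ f : Polynomial k, f ≠ 0 ∧ O.valuation (Polynomial.aeval s f) < 1) →
      4 ≤ Algebra.trdeg k K →
      ∃ m : ℕ, IsRegularLocalRing ↥(tower O A m)) ↔
    (PersistenceRadical → StrictDrop → ∀ p : ℕ, p.Prime → ∀ (k K : Type) [Field k] [CharP k p] [Field K]
      [Algebra k K] (O : ValuationSubring K) (A : Subalgebra k K), (∀ c : k, algebraMap k K c ∈ O) →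
      A.FG → IsFractionRing ↥A K → A.toSubring ≤ O.toSubring →
      (∀ O' : ValuationSubring K,
        (∀ m : ℕ, ∀ s ∈ tower O A m, s ∈ O' ∧ (s⁻¹ ∈ O' → s⁻¹ ∈ O)) → ¬ IsNoetherianRing ↥O') →
      (∀ O' : ValuationSubring K, O < O' → ∃ m : ℕ, ∃ s ∈ tower O A m, s⁻¹ ∈ O' ∧ s⁻¹ ∉ O) →
      (∀ (k' K' : Type) [Field k'] [CharP k' p] [Field K'] [Algebra k' K'] (O' : ValuationSubring K')
        (A' : Subalgebra k' K'), (∀ c : k', algebraMap k' K' c ∈ O') → A'.FG → IsFractionRing ↥A' K' →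
        A'.toSubring ≤ O'.toSubring → Algebra.trdeg k' K' < Algebra.trdeg k K →
        ∃ m : ℕ, IsRegularLocalRing ↥(tower O' A' m)) →
      (∀ m : ℕ, ∀ s ∈ tower O A m, ∃ f : Polynomial k, f ≠ 0 ∧ O.valuation (Polynomial.aeval s f) < 1) →
      4 ≤ Algebra.trdeg k K →
      False) := by
  constructor
  · intro h hP hD p hp k K _ _ _ _ O A hk hA hfr hAO hker hmax IH hzd htr
    obtain ⟨m, hm⟩ := h hP hD p hp k K O A hk hA hfr hAO hker hmax IH hzd htr
    exact not_isRegularLocalRing_of_kernel O A hk hfr hAO hker m hm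
  · intro h hP hD p hp k K _ _ _ _ O A hk hA hfr hAO hker hmax IH hzd htr
    exact (h hP hD p hp k K O A hk hA hfr hAO hker hmax IH hzd htr).elim

/-- **Generic form**: for ANY binder package `Φ` after the kernel block, «⊢ ∃ m regular» ⟺ «⊢ False» (capture conclusions — Cap3,
CapHigh, BoundedRung3 — are termination under `StrictDrop` by `NoetherianCapture.terminates_of_noetherianCapture_subalgebra`). [this work] -/
theorem kernelText_iff_noDatum
    (Φ : ∀ (k K : Type) [Field k] [Field K] [Algebra k K], ValuationSubring K → Subalgebra k K → Prop) :
    (PersistenceRadical → StrictDrop → ∀ p : ℕ, p.Prime → ∀ (k K : Type) [Field k] [CharP k p] [Field K]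
      [Algebra k K] (O : ValuationSubring K) (A : Subalgebra k K), (∀ c : k, algebraMap k K c ∈ O) →
      A.FG → IsFractionRing ↥A K → A.toSubring ≤ O.toSubring →
      (∀ O' : ValuationSubring K,
        (∀ m : ℕ, ∀ s ∈ tower O A m, s ∈ O' ∧ (s⁻¹ ∈ O' → s⁻¹ ∈ O)) → ¬ IsNoetherianRing ↥O') →
      Φ k K O A → ∃ m : ℕ, IsRegularLocalRing ↥(tower O A m)) ↔
    (PersistenceRadical → StrictDrop → ∀ p : ℕ, p.Prime → ∀ (k K : Type) [Field k] [CharP k p] [Field K]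
      [Algebra k K] (O : ValuationSubring K) (A : Subalgebra k K), (∀ c : k, algebraMap k K c ∈ O) →
      A.FG → IsFractionRing ↥A K → A.toSubring ≤ O.toSubring →
      (∀ O' : ValuationSubring K,
        (∀ m : ℕ, ∀ s ∈ tower O A m, s ∈ O' ∧ (s⁻¹ ∈ O' → s⁻¹ ∈ O)) → ¬ IsNoetherianRing ↥O') →
      Φ k K O A → False) := by
  constructor
  · intro h hP hD p hp k K _ _ _ _ O A hk hA hfr hAO hker hΦ
    obtain ⟨m, hm⟩ := h hP hD p hp k K O A hk hA hfr hAO hker hΦ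
    exact not_isRegularLocalRing_of_kernel O A hk hfr hAO hker m hm
  · intro h hP hD p hp k K _ _ _ _ O A hk hA hfr hAO hker hΦ
    exact (h hP hD p hp k K O A hk hA hfr hAO hker hΦ).elim

end Summit.ResolutionOfSingularities.ResolutionOfSingularities.Theorems.NoZeno.DiscreteDominator

end
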